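import Literature.Geometry.Riemannian.PinchingEstimatesCompactness
import Literature.Geometry.Riemannian.PinchingEstimatesImproving
import HarnessLib

/-!
# Chen–Zhu's Lemma 2.1 reduced to the maximum principle and Hamilton's Thm. 2.3 (ODE part)
(topic `Geometry/Riemannian`)

Part of the decomposition of `Literature.Geometry.Riemannian.hamilton_chenZhu_pinching`
(`PinchingEstimates.lean`). With the ODE part of Hamilton 1997, Thm. 2.1 (with Lemma 2.2) now
PROVED (`hamilton1997_B21_ode`, `PinchingEstimatesImproving.lean`), the reduction
`hamilton_chenZhu_pinching_of_ode₂` (`PinchingEstimatesCompactness.lean`) loses one more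
hypothesis:

* `hamilton_chenZhu_pinching_of_ode₁` — `hamilton_chenZhu_pinching` follows from the named fact
  `hamilton_maximumPrinciple_curvatureODE` (Hamilton 1986, Thm. 4.3 / Chow–Lu 2004, Thm. 3, for
  the curvature ODE of the Ricci flow) and the ODE part of Hamilton 1997, Thm. 2.3 alone.

## References

* R. S. Hamilton, Comm. Anal. Geom. 5 (1997), §2.2, Thms. 2.1, 2.3, Lemma 2.2 (pp. 13–21). [Hamilton1997]
* B.-L. Chen, X.-P. Zhu, J. Differential Geom. 74 (2006), §2, Lemma 2.1. [ChenZhu2006]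
-/

noncomputable section

open Set Real
open scoped Matrix

namespace Literature.Geometry.Riemannian

open HamiltonODE

universe u

/-- **Chen–Zhu 2006, Lemma 2.1 from the maximum principle for the curvature ODE and the ODE part
of Hamilton 1997, Thm. 2.3** (`hamilton_chenZhu_pinching_of_ode₂` with its Thm. 2.1 hypothesis
discharged by `hamilton1997_B21_ode`). [cite: ChenZhu2006, §2, Lemma 2.1] [cite: Hamilton1997, §2.2, Thm. 2.3 (p. 17)] -/
theorem hamilton_chenZhu_pinching_of_ode₁ (hMP : hamilton_maximumPrinciple_curvatureODE.{u})
    (h23 : ∀ m Λ Ξ ρ Ω K : ℝ, 0 < m → 0 < Λ → 0 < Ξ → 0 < ρ → 0 < Ω →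
      ∃ Q : ℝ, 2 ≤ Q ∧ ∃ L₀ P₀ : ℝ, ∀ L P : ℝ, L₀ ≤ L → P₀ ≤ P → 0 < L → 0 < P →
        IsInvariantRel field
          (fun t ↦ {p | (p.1.IsSymm ∧ p.2.2.IsSymm) ∧ p.1.TwoSmallestEigenvaluesSumGE m ∧
            p.2.2.TwoSmallestEigenvaluesSumGE m ∧ SingularValuesSumSqLE p Λ ∧
            MaxLEPairSum p Ξ ∧ p.1.trace = p.2.2.trace ∧
            Matrix.PinchedBy p.1 p.2.1 p.2.2 ρ Ω ∧ ImprovedPinching p K ∧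
            SingularValueLEExp p (L / 2) P ρ t})
          (fun t ↦ {p | ImprovedPinchingQ p ρ L P Q t})) :
    hamilton_chenZhu_pinching.{u} :=
  hamilton_chenZhu_pinching_of_ode₂ hMP hamilton1997_B21_ode h23

end Literature.Geometry.Riemannian

end
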